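import Mathlib
import Literature.InformationTheory.Entropy.GibbsInequality
import Summits.Ventures.LatticeQCDFlow.Scaling.ImportanceWeights
import Summits.Ventures.LatticeQCDFlow.Scaling.VarianceLaws

/-!
# LatticeQCDFlow / Scaling — the entropy budget of an exact flow, I: the log-Jacobian budget

HONEST FRAMING: exact (Metropolis-corrected) sampling algorithms for lattice gauge theory;
figures of merit are autocorrelation/cost numbers at stated couplings and volumes; no
continuum-physics claim.

Venture `LatticeQCDFlow` (cell pub-lqcd), topic `Scaling`, THEORY-2.md §3.2 v2.0 / §4 row T2-AG
(theory seat GEN-9).  Finite state spaces throughout (`X` a `Fintype`; a law is a vector `X → ℝ`),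
the conventions of `Scaling/ImportanceWeights.lean` (`essFrac`, `klFin`, `weight`) and
`Scaling/VarianceLaws.lean` (`varLaw`, `logW`).  Part II (`Scaling/FreeEnergyBudget.lean`) evaluates
the right-hand sides for tilted (Boltzmann) targets.

THE LAW.  A flow sampler transports a prior `ν` along a bijection `T` to a model `q = T_* ν` and
reweights / Metropolis-corrects against the target `p`.  Write `η` for the reference law (the
finite stand-in for product Haar measure; on a finite space the "Jacobian" of `T` relative to `η`
at `y` is the cell-volume ratio `η (T⁻¹ y) / η y`).  Then, with `ESS = essFrac p q`:

* `essFrac_le_mul_exp_neg_klFin` — if `q ≤ C·η` pointwise then `ESS ≤ C · exp(−D(p‖η))`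
  (from `klFin_le_klFin_add_log : D(p‖η) ≤ D(p‖q) + log C` and T2-A);
* `essFrac_pushLaw_le` / `klFin_add_log_essFrac_le` — for `q = T_* ν` with prior density
  `ν ≤ M·η` and volume distortion `η (T⁻¹ y) ≤ J·η y`:  `ESS ≤ M·J·exp(−D(p‖η))`, i.e. the
  **log-Jacobian budget** `log M + log J ≥ D(p‖η) − log(1/ESS)`;
* `klFin_ref_eq` — the exact bookkeeping identity
  `D(p‖η) = D(p‖q) + E_{T^* p}[log(ν/η)] + E_p[logJac]`, and `sum_logJac_ge` — the MEAN
  contraction the flow must realise where the target lives: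
  `E_p[logJac] ≥ D(p‖η) − log(1/ESS) − E_{T^* p}[log(ν/η)]`;
* `sub_sq_le_chiSq_mul_varLaw` — `(E_r f − E_ν f)² ≤ χ²(r‖ν)·Var_ν f` with `χ² = 1/ESS(r,ν) − 1`,
  which controls the prior term by `D(ν‖η) + √((1/ESS − 1)·Var_ν log(ν/η))` (`sum_logJac_ge'`).

On the lattice (`η` = Haar, `p` = Wilson measure) `D(p_β‖Haar) = (n_tr/2)·log β + Θ(V)` with
`n_tr = dim G·((d−1)V − O(V/L))` (THEORY-2.md §3.2 v2.0: U(N) by Chatterjee, J. Funct. Anal. 271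
(2016) = arXiv:1602.01222 Thm 2.1 and Brennecke arXiv:2511.07297 Thm 1–2; U(1)/SU(N) two-sided
bounds by plaquette peeling + tree-gauge small balls), so the log-Jacobian CAPACITY of any flow with
non-negligible ESS must grow like `(n_tr/2)·log β` — extensive in the volume, logarithmic in the
coupling.  Those lattice evaluations are NOT formalised here; everything in this file is an
elementary finite-sum theorem, `[folklore]` level, no `sorry`.
-/

namespace Summit.Ventures.LatticeQCDFlow.Theory2

open Finset

variable {X : Type*} [Fintype X]

/-! ## 1. Dominated models: `q ≤ C·η` -/

/-- If the model is dominated by the reference, `q ≤ C·η`, then `D(p‖η) ≤ D(p‖q) + log C`.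
[folklore] -/
theorem klFin_le_klFin_add_log {p q η : X → ℝ} (hp : ∀ x, 0 < p x) (hp1 : ∑ x, p x = 1)
    (hq : ∀ x, 0 < q x) (hη : ∀ x, 0 < η x) {C : ℝ} (hC : ∀ x, q x ≤ C * η x) :
    klFin p η ≤ klFin p q + Real.log C := by
  have hterm : ∀ x, p x * Real.log (p x / η x) ≤
      p x * Real.log (p x / q x) + p x * Real.log C := by
    intro x
    have hq' := (hq x).ne'
    have hsplit : p x / q x * (q x / η x) = p x / η x := by
      rw [div_mul_div_comm, mul_comm (p x) (q x), mul_div_mul_left _ _ hq']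
    rw [← hsplit, Real.log_mul (div_pos (hp x) (hq x)).ne' (div_pos (hq x) (hη x)).ne', mul_add]
    have hlog : Real.log (q x / η x) ≤ Real.log C :=
      Real.log_le_log (div_pos (hq x) (hη x)) ((div_le_iff₀ (hη x)).mpr (hC x))
    have := mul_le_mul_of_nonneg_left hlog (hp x).le
    linarith
  calc klFin p η = ∑ x, p x * Real.log (p x / η x) := rfl
    _ ≤ ∑ x, (p x * Real.log (p x / q x) + p x * Real.log C) := sum_le_sum fun x _ => hterm x
    _ = klFin p q + Real.log C := by
        rw [sum_add_distrib, ← sum_mul, hp1, one_mul]; rfl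

omit [Fintype X] in
/-- A domination constant is positive as soon as the dominated law is. -/
theorem pos_of_dominates {q η : X → ℝ} {C : ℝ} (x : X) (hq : 0 < q x) (hη : 0 < η x)
    (hC : q x ≤ C * η x) : 0 < C :=
  (mul_pos_iff_of_pos_right hη).mp (lt_of_lt_of_le hq hC)

/-- A normalised law lives on a nonempty type. -/
theorem nonempty_of_sum_eq_one {p : X → ℝ} (hp1 : ∑ x, p x = 1) : Nonempty X := by
  by_contra h
  haveI : IsEmpty X := not_nonempty_iff.mp h
  simp at hp1

/-- **T2-AG (sup form).**  `q ≤ C·η` pointwise ⟹ `ESS(p,q) ≤ C · exp(−D(p‖η))`: a model whose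
density against the reference is bounded by `C` cannot have ESS above `C·e^{−D(p‖η)}` — the
target's entropy deficit relative to the reference must be paid for by density CONCENTRATION of
the model. [folklore] -/
theorem essFrac_le_mul_exp_neg_klFin {p q η : X → ℝ} (hp : ∀ x, 0 < p x) (hp1 : ∑ x, p x = 1)
    (hq : ∀ x, 0 < q x) (hη : ∀ x, 0 < η x) {C : ℝ} (hC : ∀ x, q x ≤ C * η x) :
    essFrac p q ≤ C * Real.exp (-klFin p η) := by
  obtain ⟨x⟩ := nonempty_of_sum_eq_one hp1
  have hCpos : 0 < C := pos_of_dominates x (hq x) (hη x) (hC x)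
  have h1 := essFrac_le_exp_neg_kl hp hq hp1
  have h2 := klFin_le_klFin_add_log hp hp1 hq hη hC
  calc essFrac p q ≤ Real.exp (-klFin p q) := h1
    _ ≤ Real.exp (Real.log C - klFin p η) := Real.exp_le_exp.mpr (by linarith)
    _ = C * Real.exp (-klFin p η) := by
        rw [Real.exp_sub, Real.exp_log hCpos, Real.exp_neg, div_eq_mul_inv]

/-- Logarithmic form: `D(p‖η) + log ESS ≤ log C`. -/
theorem klFin_add_log_essFrac_le_log {p q η : X → ℝ} (hp : ∀ x, 0 < p x) (hp1 : ∑ x, p x = 1)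
    (hq : ∀ x, 0 < q x) (hη : ∀ x, 0 < η x) {C : ℝ} (hC : ∀ x, q x ≤ C * η x) :
    klFin p η + Real.log (essFrac p q) ≤ Real.log C := by
  obtain ⟨x⟩ := nonempty_of_sum_eq_one hp1
  have hCpos : 0 < C := pos_of_dominates x (hq x) (hη x) (hC x)
  have hE : 0 < essFrac p q := essFrac_pos hq hp1
  have h := essFrac_le_mul_exp_neg_klFin hp hp1 hq hη hC
  have hlog := Real.log_le_log hE h
  rw [Real.log_mul hCpos.ne' (Real.exp_pos _).ne', Real.log_exp] at hlog
  linarith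

/-! ## 2. Flows: transport of the prior along a bijection -/

/-- The model law of a (finite) flow: the prior `ν` transported along the bijection `T`,
`q y = ν (T⁻¹ y)` (mass is carried; no Jacobian for masses). -/
def pushLaw (T : X ≃ X) (ν : X → ℝ) : X → ℝ := fun y => ν (T.symm y)

/-- The pull-back of the target along the flow, `(T^* p) x = p (T x)`. -/
def pullLaw (T : X ≃ X) (p : X → ℝ) : X → ℝ := fun x => p (T x)

/-- The log-volume change of the flow at `y` relative to the reference `η`:
`log (η (T⁻¹ y) / η y)` — the finite stand-in for `log |det D(T⁻¹)(y)| = −log |det DT|(T⁻¹ y)`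
when laws are densities against Haar/Lebesgue. -/
noncomputable def logJac (T : X ≃ X) (η : X → ℝ) (y : X) : ℝ := Real.log (η (T.symm y) / η y)

omit [Fintype X] in
/-- Unfolding lemma for `pushLaw`. -/
@[simp] theorem pushLaw_apply (T : X ≃ X) (ν : X → ℝ) (y : X) : pushLaw T ν y = ν (T.symm y) := rfl

omit [Fintype X] in
/-- Unfolding lemma for `pullLaw`. -/
@[simp] theorem pullLaw_apply (T : X ≃ X) (p : X → ℝ) (x : X) : pullLaw T p x = p (T x) := rfl

/-- Transport preserves total mass: `Σ T_*ν = Σ ν`. -/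
theorem sum_pushLaw (T : X ≃ X) (ν : X → ℝ) : ∑ y, pushLaw T ν y = ∑ x, ν x :=
  T.symm.sum_comp ν

/-- Pull-back preserves total mass: `Σ T^*p = Σ p`. -/
theorem sum_pullLaw (T : X ≃ X) (p : X → ℝ) : ∑ x, pullLaw T p x = ∑ y, p y :=
  T.sum_comp p

omit [Fintype X] in
/-- A positive prior transports to a positive model. -/
theorem pushLaw_pos (T : X ≃ X) {ν : X → ℝ} (hν : ∀ x, 0 < ν x) (y : X) : 0 < pushLaw T ν y :=
  hν _

omit [Fintype X] in
/-- Domination transports: prior density `≤ M` and volume distortion `≤ J` give a model of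
density `≤ M·J` against the reference. -/
theorem pushLaw_le (T : X ≃ X) {ν η : X → ℝ} (hν : ∀ x, 0 < ν x) (hη : ∀ x, 0 < η x)
    {M J : ℝ} (hM : ∀ x, ν x ≤ M * η x) (hJ : ∀ y, η (T.symm y) ≤ J * η y) (y : X) :
    pushLaw T ν y ≤ (M * J) * η y := by
  have hMpos : 0 < M := pos_of_dominates (T.symm y) (hν _) (hη _) (hM _)
  calc pushLaw T ν y = ν (T.symm y) := rfl
    _ ≤ M * η (T.symm y) := hM _
    _ ≤ M * (J * η y) := mul_le_mul_of_nonneg_left (hJ y) hMpos.le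
    _ = (M * J) * η y := by ring

/-- **T2-AG (flow form).**  A flow with prior density `≤ M` and volume distortion `≤ J`
(relative to the reference `η`) has `ESS ≤ M·J·exp(−D(p‖η))` against any target `p`. -/
theorem essFrac_pushLaw_le (T : X ≃ X) {p ν η : X → ℝ} (hp : ∀ x, 0 < p x)
    (hp1 : ∑ x, p x = 1) (hν : ∀ x, 0 < ν x) (hη : ∀ x, 0 < η x) {M J : ℝ}
    (hM : ∀ x, ν x ≤ M * η x) (hJ : ∀ y, η (T.symm y) ≤ J * η y) :
    essFrac p (pushLaw T ν) ≤ (M * J) * Real.exp (-klFin p η) :=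
  essFrac_le_mul_exp_neg_klFin hp hp1 (pushLaw_pos T hν) hη (pushLaw_le T hν hη hM hJ)

/-- **The log-Jacobian budget.**  `D(p‖η) + log ESS ≤ log M + log J`: to reach ESS `ε` against a
target whose entropy deficit to the reference is `D`, prior concentration and flow contraction
must together supply `log M + log J ≥ D − log(1/ε)`. -/
theorem klFin_add_log_essFrac_le (T : X ≃ X) {p ν η : X → ℝ} (hp : ∀ x, 0 < p x)
    (hp1 : ∑ x, p x = 1) (hν : ∀ x, 0 < ν x) (hη : ∀ x, 0 < η x) {M J : ℝ}
    (hM : ∀ x, ν x ≤ M * η x) (hJ : ∀ y, η (T.symm y) ≤ J * η y) :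
    klFin p η + Real.log (essFrac p (pushLaw T ν)) ≤ Real.log M + Real.log J := by
  obtain ⟨x⟩ := nonempty_of_sum_eq_one hp1
  have hMpos : 0 < M := pos_of_dominates x (hν x) (hη x) (hM x)
  have hJpos : 0 < J :=
    pos_of_dominates (q := fun y => η (T.symm y)) (η := η) x (hη (T.symm x)) (hη x) (hJ x)
  have h := klFin_add_log_essFrac_le_log hp hp1 (pushLaw_pos T hν) hη (pushLaw_le T hν hη hM hJ)
  rwa [Real.log_mul hMpos.ne' hJpos.ne'] at h

/-! ## 3. The exact bookkeeping identity and the mean contraction -/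

/-- `D(p‖η) = D(p‖T_*ν) + E_{T^*p}[log(ν/η)] + E_p[logJac]`: the target's entropy deficit splits
exactly into the model mismatch, the prior's log-density seen through the flow, and the mean
log-volume change of the flow UNDER THE TARGET. [folklore: change of variables] -/
theorem klFin_ref_eq (T : X ≃ X) {p ν η : X → ℝ} (hp : ∀ x, 0 < p x) (hν : ∀ x, 0 < ν x)
    (hη : ∀ x, 0 < η x) :
    klFin p η = klFin p (pushLaw T ν) + ∑ x, pullLaw T p x * logW ν η x
      + ∑ y, p y * logJac T η y := by
  -- reindex the middle sum along `T`: Σ_x p(Tx) ℓ(x) = Σ_y p y ℓ(T⁻¹ y)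
  have hre : ∑ x, pullLaw T p x * logW ν η x = ∑ y, p y * logW ν η (T.symm y) := by
    rw [← T.symm.sum_comp (fun x => pullLaw T p x * logW ν η x)]
    simp [pullLaw]
  rw [hre, klFin, klFin, ← sum_add_distrib, ← sum_add_distrib]
  refine sum_congr rfl fun y _ => ?_
  have hν' := (hν (T.symm y)).ne'
  have hη' := (hη (T.symm y)).ne'
  have hηy := (hη y).ne'
  have hprod : p y / ν (T.symm y) * (ν (T.symm y) / η (T.symm y)) * (η (T.symm y) / η y) =
      p y / η y := by
    field_simp
  rw [← mul_add, ← mul_add]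
  congr 1
  rw [pushLaw_apply, logW, logJac,
    ← Real.log_mul (div_pos (hp y) (hν _)).ne' (div_pos (hν _) (hη _)).ne',
    ← Real.log_mul (mul_pos (div_pos (hp y) (hν _)) (div_pos (hν _) (hη _))).ne'
      (div_pos (hη _) (hη y)).ne', hprod]

/-- `D(p‖q) ≤ log(1/ESS) = −log ESS` (Jensen; the logarithmic reading of T2-A). -/
theorem klFin_le_neg_log_essFrac {p q : X → ℝ} (hp : ∀ x, 0 < p x) (hq : ∀ x, 0 < q x)
    (hp1 : ∑ x, p x = 1) : klFin p q ≤ -Real.log (essFrac p q) := by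
  have hE : 0 < essFrac p q := essFrac_pos hq hp1
  have h := Real.log_le_log hE (essFrac_le_exp_neg_kl hp hq hp1)
  rw [Real.log_exp] at h
  linarith

/-- **T2-AG (mean form).**  The mean log-volume change of the flow under the target is at least
`D(p‖η) − log(1/ESS) − E_{T^*p}[log(ν/η)]`. -/
theorem sum_logJac_ge (T : X ≃ X) {p ν η : X → ℝ} (hp : ∀ x, 0 < p x) (hp1 : ∑ x, p x = 1)
    (hν : ∀ x, 0 < ν x) (hη : ∀ x, 0 < η x) :
    klFin p η + Real.log (essFrac p (pushLaw T ν)) - ∑ x, pullLaw T p x * logW ν η x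
      ≤ ∑ y, p y * logJac T η y := by
  have h1 := klFin_ref_eq T hp hν hη
  have h2 := klFin_le_neg_log_essFrac hp (pushLaw_pos T hν) hp1
  linarith

/-! ## 4. Controlling the prior term: `(E_r f − E_ν f)² ≤ χ²(r‖ν) · Var_ν f` -/

/-- **Covariance (χ²–variance) inequality.**  For a positive law `ν` and any `r` with the same
total mass `1`: `(Σ r f − Σ ν f)² ≤ (Σ r²/ν − 1) · Var_ν f`; and `Σ r²/ν − 1 = 1/ESS(r,ν) − 1 =
χ²(r‖ν)` (`essFrac_eq_sq_div`).  Weighted Cauchy–Schwarz. [folklore] -/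
theorem sub_sq_le_chiSq_mul_varLaw {r ν : X → ℝ} (hν : ∀ x, 0 < ν x) (hr1 : ∑ x, r x = 1)
    (hν1 : ∑ x, ν x = 1) (f : X → ℝ) :
    (∑ x, r x * f x - ∑ x, ν x * f x) ^ 2 ≤ (∑ x, r x ^ 2 / ν x - 1) * varLaw ν f := by
  set m := ∑ x, ν x * f x with hm
  -- centre: Σ r f − Σ ν f = Σ (r − ν)(f − m)
  have hcen : ∑ x, r x * f x - ∑ x, ν x * f x = ∑ x, (r x - ν x) * (f x - m) := by
    have : ∑ x, (r x - ν x) * (f x - m) =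
        ∑ x, (r x * f x - ν x * f x) - m * ∑ x, (r x - ν x) := by
      rw [mul_sum, ← sum_sub_distrib]; exact sum_congr rfl fun x _ => by ring
    rw [this, sum_sub_distrib, sum_sub_distrib, hr1, hν1, sub_self, mul_zero, sub_zero]
  -- χ² = Σ (r − ν)²/ν
  have hchi : ∑ x, r x ^ 2 / ν x - 1 = ∑ x, (r x - ν x) ^ 2 / ν x := by
    have e : ∀ x, (r x - ν x) ^ 2 / ν x = r x ^ 2 / ν x - 2 * r x + ν x := fun x => by
      have := (hν x).ne'
      field_simp
      ring
    simp_rw [e]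
    rw [sum_add_distrib, sum_sub_distrib, ← mul_sum, hr1, hν1]
    ring
  rw [hcen, hchi, varLaw_eq_sum_sq_dev hν1, ← hm]
  refine sum_sq_le_sum_mul_sum_of_sq_le_mul univ
    (fun x _ => div_nonneg (sq_nonneg _) (hν x).le)
    (fun x _ => mul_nonneg (hν x).le (sq_nonneg _)) (fun x _ => le_of_eq ?_)
  have := (hν x).ne'
  field_simp

/-- ESS is transported: `ESS(p, T_*ν) = ESS(T^*p, ν)`. -/
theorem essFrac_pullback (T : X ≃ X) (p ν : X → ℝ) (hν : ∀ x, 0 < ν x) :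
    essFrac p (pushLaw T ν) = essFrac (pullLaw T p) ν := by
  rw [essFrac_eq_sq_div (fun y => (pushLaw_pos T hν y).ne'),
    essFrac_eq_sq_div (fun x => (hν x).ne'), sum_pullLaw]
  congr 1
  rw [← T.sum_comp (fun y => p y ^ 2 / pushLaw T ν y)]
  simp [pullLaw]

/-- The prior term of `klFin_ref_eq`, bounded by the prior's own entropy deficit plus a
χ²–variance correction: `E_{T^*p}[log(ν/η)] ≤ D(ν‖η) + √((1/ESS − 1) · Var_ν log(ν/η))`. -/
theorem sum_pullLaw_logW_le (T : X ≃ X) {p ν η : X → ℝ} (hp1 : ∑ x, p x = 1)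
    (hν : ∀ x, 0 < ν x) (hν1 : ∑ x, ν x = 1) :
    ∑ x, pullLaw T p x * logW ν η x ≤ klFin ν η +
      Real.sqrt (((essFrac p (pushLaw T ν))⁻¹ - 1) * varLaw ν (logW ν η)) := by
  have hr1 : ∑ x, pullLaw T p x = 1 := by rw [sum_pullLaw, hp1]
  have hcs := sub_sq_le_chiSq_mul_varLaw hν hr1 hν1 (logW ν η)
  have hchi : ∑ x, pullLaw T p x ^ 2 / ν x - 1 = (essFrac p (pushLaw T ν))⁻¹ - 1 := by
    rw [essFrac_pullback T p ν hν, essFrac_eq_sq_div (fun x => (hν x).ne'), hr1, one_pow,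
      inv_div, div_one]
  have hkl : ∑ x, ν x * logW ν η x = klFin ν η := rfl
  rw [hchi, hkl] at hcs
  have hsq := Real.sqrt_le_sqrt hcs
  rw [Real.sqrt_sq_eq_abs] at hsq
  linarith [le_abs_self (∑ x, pullLaw T p x * logW ν η x - klFin ν η)]

/-- **T2-AG (entropic form).**  Mean contraction of the flow under the target
`≥ D(p‖η) − D(ν‖η) − log(1/ESS) − √((1/ESS − 1)·Var_ν log(ν/η))`. -/
theorem sum_logJac_ge' (T : X ≃ X) {p ν η : X → ℝ} (hp : ∀ x, 0 < p x) (hp1 : ∑ x, p x = 1)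
    (hν : ∀ x, 0 < ν x) (hν1 : ∑ x, ν x = 1) (hη : ∀ x, 0 < η x) :
    klFin p η - klFin ν η + Real.log (essFrac p (pushLaw T ν))
      - Real.sqrt (((essFrac p (pushLaw T ν))⁻¹ - 1) * varLaw ν (logW ν η))
      ≤ ∑ y, p y * logJac T η y := by
  have h1 := sum_logJac_ge T hp hp1 hν hη
  have h2 := sum_pullLaw_logW_le T (η := η) hp1 hν hν1
  linarith

end Summit.Ventures.LatticeQCDFlow.Theory2
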